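import Summits.AtomisticToContinuum.Crystallization.Theorems.OverbindingBudgetAffineCompressedCut

namespace Summit.AtomisticToContinuum.Crystallization.Theorems.OverbindingBudgetAffineCompressedCut

open scoped BigOperators Classical
open Literature.MathematicalPhysics.StatisticalMechanics
open Literature.Geometry.DiscreteGeometry (IsChargeFree nearestDist nearestDist_nonneg nearestDist_le_dist)
open Summit.AtomisticToContinuum.Crystallization.Theorems.OverbindingBudgetMisfitRegistration (Framed Reg DeepReg)
open Summit.AtomisticToContinuum.Crystallization.Theorems.OverbindingBudgetMisfitWindowStatements (InWindow offCount)
open Summit.AtomisticToContinuum.Crystallization.Theorems.OverbindingBudgetBalancedCensusStatements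
open Summit.AtomisticToContinuum.Crystallization.Theorems.OverbindingBudgetAffineLadder
open Summit.AtomisticToContinuum.Crystallization.Theorems.OverbindingBudgetAffineLocalisation (pairSum two_mul_interactionEnergy_eq_pairSum
  pairSum_univ_left pairSum_univ_right card_mul_floor_le_half_pairSum)
open Summit.AtomisticToContinuum.Crystallization.Theorems.OverbindingBudgetAffineMesoCut
open Summit.AtomisticToContinuum.Crystallization.Theorems.OverbindingBudgetAffinePhaseCut
open Summit.AtomisticToContinuum.Crystallization.Theorems.OverbindingBudgetAffineCushionCut
open Summit.AtomisticToContinuum.Crystallization.Theorems.OverbindingBudgetAffineTwinCut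
open Summit.AtomisticToContinuum.Crystallization.Theorems.OverbindingBudgetAffineRunCut

/-! ## §6b  PROVED: the ECONOMICAL instance `s₀ = 17/50 = (2/5)·s₁` (g79 addendum) — `NearFieldSlackMin 12 (1/25) → CompressedRun` -/

/-- **`NearFieldSlackMin R κ`** («NS♭»): the near-field law with the first (letter-free) priced class shrunk from `nn < 1/2` to
`nn < 17/50 = (2/5)·(17/20)` — the least `s₀` the far-field law tolerates (`2·s₁ ≤ 5·s₀` with equality); second class and weights unchanged.
At `(R, κ) = (12, 1/25)` its FIRST class closes by PACKING ALONE with a `7×` margin (first-shell repulsion `≥ ½·12·V(53/50·nn_i) ≈ 1.0·10⁵` at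
`nn_i = 17/50` against the crude per-shell count of the `(2/5)·nn_i`-separated pullers beyond `3/2·nn_i`, `≤ 23·nn_i⁻⁶ ≈ 1.5·10⁴`; at `s₀ = 1/2`
the same count is too lossy and the discrete Abel / Stieltjes form of the shell count is needed, memo §5 (b)); its SECOND (affine) class is NS's.
[this file · kind: statement · prices FEWER sites than `NearFieldSlack R κ` but is NOT comparable to it as an implication (a partner with
`nn ∈ [17/50, 1/2)` turns from priced — weight `½` or `1` — into sound-unpriced — weight `1` —, which LOWERS an attractive load); TRUE-type by the
same pessimistic budget (attraction already at weight `1`) · first class ATTACKABLE-S, second class ATTACKABLE-M — the recommended open leaf] -/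
def NearFieldSlackMin (R κ : ℝ) : Prop :=
  ∀ δ : ℝ, 0 < δ → δ ≤ 2 → NearFieldSlackAt 64 12 (1 / 10 ^ 4) (1 / 1000) (17 / 50) (17 / 20) (3 / 50) (1 / 450) δ R κ

/-- The far-field law at `s₀ = 17/50`, `(R, κ) = (12, 1/25)` — PROVED by the same sharp shell sum (`2·(17/20) ≤ 5·(17/50)`). [this file] -/
theorem farFieldControlAt_min {δ : ℝ} (hδ : 0 < δ) :
    FarFieldControlAt 64 12 (1 / 10 ^ 4) (1 / 1000) (17 / 50) (17 / 20) (3 / 50) (1 / 450) δ 12 (1 / 25) :=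
  farFieldControlAt_of_twoScale twoScaleShellBound_21 (by norm_num) hδ (by norm_num) (by norm_num) (by norm_num)

/-- **`NearFieldSlackMin 12 (1/25) → CompressedRun`** — the ECONOMICAL LEAF FORM (generic seams of §4–§6 at `s₀ = 17/50`). [this file] -/
theorem compressedRun_of_nearFieldSlackMin (hN : NearFieldSlackMin 12 (1 / 25)) : CompressedRun :=
  fun δ hδ hδ2 => balancedCompressedRunGapW_of_compressedDeepAt
    (compressedDeepAt_of_siteSlackAt hδ (compressedSiteSlackAt_of_near_far (hN δ hδ hδ2) (farFieldControlAt_min hδ)))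

end Summit.AtomisticToContinuum.Crystallization.Theorems.OverbindingBudgetAffineCompressedCut
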